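import Summits.QuantumFields.YangMills.Theorems.SkewnessNonGeneration.Negative.DilationCovariance
import Summits.QuantumFields.YangMills.Theorems.CurvatureBoostCovariance.Negative.BetaZeroTie
import Summits.QuantumFields.YangMills.Theorems.LatticeGapOnTrajectory.Negative.ZeroCouplingGap

/-!
# K2: the zero-coupling model is extinct — `hw` admits no junk refutation (negative-side lemmas)

For `BoundedSkewnessRunning.SkewnessNonGeneration` (K2, item `stmt-QuantumFields-19896`).  The only
uniformly gapped Wilson scheme the tree can construct is zero coupling, `β ≡ 0` (independent Haar
links: `hasLatticeMassGap_of_zero_coupling` gives `HasLatticeMassGap r sch Δ` for EVERY `Δ`); it is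
excluded from K2 only by the weak-coupling hypothesis `hw : β_k → ∞`.  Here: at every zero-coupling
step the window two-point function `T_k(u)` of a past-supported `u` VANISHES
(`cruxT_eq_zero_of_beta_zero` — by the tree's exact `β = 0` formula `latticeSchwinger_beta_zero` the
curvature is a c-number field on tensors vanishing on the diagonal, and `u ⊗ Θu` is one), so the
self-normalisation collapses and `κ₃^canon_k = 0` (`cruxKappa3_eq_zero_of_beta_zero`,
`tendsto_cruxKappa3_of_eventually_beta_zero`).  Consequently the `β ≡ 0` model meets every
hypothesis of K2 on the gapped scheme except `hw` — the gap at every `Δ`, the RP window at every `M`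
— AND ITS CONCLUSION (`zeroCoupling_meets_K2_sans_weakCoupling`): deleting `hw` from K2 (or from its
companion-free form `CF`) opens no junk refutation; a refutation of that strengthening needs
genuinely correlated plaquettes (`β_k ≠ 0` frequently, `T_k(u) > 0` frequently) under a uniform
lattice gap — strong coupling by cluster expansion (not in the tree) or weak coupling (open).
-/

noncomputable section

open scoped SchwartzMap Topology
open MeasureTheory Filter Set
open Literature.MathematicalPhysics.AQFT Literature.MathematicalPhysics.QuantumLattice
open Literature.MathematicalPhysics.QuantumFieldTheory
open Summit.QuantumFields.YangMills.Theorems.SelfNormalisedSkewness.Negative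
open Summit.QuantumFields.YangMills.Theorems.CurvatureBoostCovariance.Negative
  (latticeSchwinger_beta_zero eventually_lt_side)
open Summit.QuantumFields.YangMills.Theorems.LatticeGapOnTrajectory.Negative
  (hasLatticeMassGap_of_zero_coupling)

namespace Summit.QuantumFields.YangMills.Theorems.SkewnessNonGeneration.Negative

/-! ## (e′) Load-bearing analysis: `hw` has no junk refutation — the zero-coupling model is extinct -/

section ZeroCoupling

variable {G : Type} [Group G] [TopologicalSpace G] [IsTopologicalGroup G] [CompactSpace G]
  [MeasurableSpace G] [BorelSpace G]

omit [Group G] [TopologicalSpace G] [IsTopologicalGroup G] [CompactSpace G] [MeasurableSpace G]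
  [BorelSpace G] in
/-- A past-supported test function vanishes on the closed future half-space `{x⁰ ≥ 0}`. [folklore] -/
theorem apply_eq_zero_of_past {w : 𝓢(E4, ℝ)} (hw : tsupport (w : E4 → ℝ) ⊆ {y : E4 | y 0 < 0})
    {x : E4} (hx : 0 ≤ x 0) : w x = 0 :=
  image_eq_zero_of_notMem_tsupport fun h => absurd (hw h) (not_lt.2 hx)

omit [Group G] [TopologicalSpace G] [IsTopologicalGroup G] [CompactSpace G] [MeasurableSpace G]
  [BorelSpace G] in
/-- The reflected pair `w ⊗ Θw` of a past-supported `w` vanishes on the diagonal. [folklore] -/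
theorem apply_mul_thetaTest_apply_eq_zero {w : 𝓢(E4, ℝ)}
    (hw : tsupport (w : E4 → ℝ) ⊆ {y : E4 | y 0 < 0}) (x : E4) : w x * thetaTest 4 w x = 0 := by
  rw [thetaTest_apply]
  by_cases hx : 0 ≤ x 0
  · rw [apply_eq_zero_of_past hw hx, zero_mul]
  · have hx' : 0 ≤ (timeReflection 4 x) 0 := by
      rw [timeReflection_apply]; simp only [↓reduceIte]; linarith [not_le.1 hx]
    rw [apply_eq_zero_of_past hw hx', mul_zero]

omit [Group G] [TopologicalSpace G] [IsTopologicalGroup G] [CompactSpace G] [MeasurableSpace G]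
  [BorelSpace G] in
/-- The past shift `τ₋₁ w = w(· + e₀)` of a past-supported `w` is past-supported. [folklore] -/
theorem tsupport_timeShiftTest_neg_one_past {w : 𝓢(E4, ℝ)}
    (hw : tsupport (w : E4 → ℝ) ⊆ {y : E4 | y 0 < 0}) :
    tsupport ((timeShiftTest 4 (-1) w : 𝓢(E4, ℝ)) : E4 → ℝ) ⊆ {y : E4 | y 0 < 0} := by
  intro x hx
  have e : ((timeShiftTest 4 (-1) w : 𝓢(E4, ℝ)) : E4 → ℝ) =
      fun y => w (y - EuclideanSpace.single 0 (-1 : ℝ)) := funext fun y => timeShiftTest_apply 4 (-1) w y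
  rw [e] at hx
  have h := hw (tsupport_schwartz_comp_subset w (continuous_sub_right _) hx)
  simp only [Set.mem_setOf_eq, PiLp.sub_apply, PiLp.single_apply, ↓reduceIte] at h
  simp only [Set.mem_setOf_eq]
  linarith

/-- **`T_k(w) = 0` at a zero-coupling step.** With `β_k = 0` (independent Haar links) and
`side_k > 2`, the bare truncated two-point function of the curvature at the reflected pair
`(w, Θw)` of a past-supported `w` vanishes: by `latticeSchwinger_beta_zero` the curvature is a
c-number field on tensors vanishing on the diagonal, and `w ⊗ Θw` does. [folklore] -/
theorem cruxT_eq_zero_of_beta_zero (r : LatticeRep G) (sch : SpeciesScheme (YMSpecies G))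
    {w : 𝓢(E4, ℝ)} (hw : tsupport (w : E4 → ℝ) ⊆ {y : E4 | y 0 < 0}) {k : ℕ} (hβ : sch.β k = 0)
    (hk : 2 < sch.side k) : cruxT r sch w k = 0 := by
  have hβ' : (cruxBare sch).β k = 0 := hβ
  have h2 : 2 < (cruxBare sch).side k := hk
  have h1 : 1 < (cruxBare sch).side k := lt_trans one_lt_two hk
  have vac : ∀ (f : Fin 1 → 𝓢(E4, ℝ)) (Y : Fin 1 → Fin 4 → ℤ),
      (∀ i, Y i ∈ Literature.Probability.LatticeModels.box 4 ((cruxBare sch).L k)) →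
      ¬ Function.Injective Y → ∏ i, f i ((cruxBare sch).a k • siteToE (Y i)) = 0 :=
    fun f Y _ hY => absurd (fun i j _ => Subsingleton.elim i j) hY
  have e2 := latticeSchwinger_beta_zero r (cruxBare sch) k hβ' h2 ![w, thetaTest 4 w] (by
    intro Y _ hY
    have h01 : Y 0 = Y 1 := by
      by_contra hne
      refine hY fun i j hij => ?_
      fin_cases i <;> fin_cases j
      · rfl
      · exact absurd hij hne
      · exact absurd hij.symm hne
      · rfl
    rw [Fin.prod_univ_two]
    simp only [Matrix.cons_val_zero, Matrix.cons_val_one]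
    rw [← h01]
    exact apply_mul_thetaTest_apply_eq_zero hw _)
  have e1 := latticeSchwinger_beta_zero r (cruxBare sch) k hβ' h1 ![w] (vac _)
  have e1' := latticeSchwinger_beta_zero r (cruxBare sch) k hβ' h1 ![thetaTest 4 w] (vac _)
  unfold cruxT
  show latticeSchwinger r.ρ (cruxBare sch) (fun s => s.F) k 2 (fun _ => r.curvature)
        ![w, thetaTest 4 w] -
      latticeSchwinger r.ρ (cruxBare sch) (fun s => s.F) k 1 (fun _ => r.curvature) ![w] *
        latticeSchwinger r.ρ (cruxBare sch) (fun s => s.F) k 1 (fun _ => r.curvature)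
          ![thetaTest 4 w] = 0
  rw [e2, e1, e1']
  rw [Fin.prod_univ_two, Fin.prod_univ_one, Fin.prod_univ_one]
  simp only [Matrix.cons_val_zero, Matrix.cons_val_one]
  ring

/-- `κ₃^canon_k = 0` at every zero-coupling step `k` with `side_k > 2` (collapse of the
self-normalisation, `cruxKappa3_eq_zero_of_cruxT_nonpos`). [folklore] -/
theorem cruxKappa3_eq_zero_of_beta_zero (r : LatticeRep G) (sch : SpeciesScheme (YMSpecies G))
    {u : 𝓢(E4, ℝ)} (hu : tsupport (u : E4 → ℝ) ⊆ {y : E4 | y 0 < 0}) (f g h : 𝓢(E4, ℝ)) {k : ℕ}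
    (hβ : sch.β k = 0) (hk : 2 < sch.side k) : cruxKappa3 r sch u f g h k = 0 :=
  cruxKappa3_eq_zero_of_cruxT_nonpos r sch u f g h (cruxT_eq_zero_of_beta_zero r sch hu hβ hk).le

/-- **The zero-coupling model is extinct.** Along any scheme with `β_k = 0` eventually the
self-normalised skewness of `tr F²` tends to `0` at every past-supported `u` and EVERY triple
(disjoint or not). [folklore] -/
theorem tendsto_cruxKappa3_of_eventually_beta_zero (r : LatticeRep G)
    (sch : SpeciesScheme (YMSpecies G)) {u : 𝓢(E4, ℝ)}
    (hu : tsupport (u : E4 → ℝ) ⊆ {y : E4 | y 0 < 0}) (f g h : 𝓢(E4, ℝ))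
    (hβ : ∀ᶠ k in atTop, sch.β k = 0) : Tendsto (cruxKappa3 r sch u f g h) atTop (𝓝 0) :=
  tendsto_cruxKappa3_of_eventually_cruxT_nonpos r sch u f g h <| by
    filter_upwards [hβ, eventually_lt_side sch 2] with k hk hside
    exact (cruxT_eq_zero_of_beta_zero r sch hu hk hside).le

/-- **`hw` admits no junk refutation.** The only uniformly gapped Wilson scheme the tree can build —
zero coupling, `β ≡ 0` (independent Haar links; `hasLatticeMassGap_of_zero_coupling`) — carries
EVERY hypothesis of K2 / `CF` on the gapped scheme except `hw` (the gap at every `Δ`; the RP window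
at every `M`, both sides being `0`) AND carries the conclusion: the strengthening of K2 by deleting
`sch.HasWeakCouplingLimit` is not refuted there.  A refutation of that strengthening needs a
gapped scheme with `T_k(u) > 0` frequently, i.e. genuinely correlated plaquettes (`β_k ≠ 0`
frequently) together with a uniform lattice gap — strong coupling `0 < β ≤ β₀` by cluster expansion
(not in the tree) or weak coupling (open). [folklore] -/
theorem zeroCoupling_meets_K2_sans_weakCoupling (r : LatticeRep G)
    (sch : SpeciesScheme (YMSpecies G)) (hβ : ∀ k, sch.β k = 0) :
    (∀ Δ : ℝ, HasLatticeMassGap r sch Δ) ∧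
    (∀ (u : 𝓢(E4, ℝ)) (M : ℝ), tsupport (u : E4 → ℝ) ⊆ {y : E4 | y 0 < 0} →
      ∀ᶠ k in atTop, cruxT r sch u k ≤ M * cruxT r sch (timeShiftTest 4 (-1) u) k) ∧
    (∀ (u f g h : 𝓢(E4, ℝ)), tsupport (u : E4 → ℝ) ⊆ {y : E4 | y 0 < 0} →
      Tendsto (cruxKappa3 r sch u f g h) atTop (𝓝 0)) := by
  refine ⟨hasLatticeMassGap_of_zero_coupling r sch hβ, ?_, ?_⟩
  · intro u M hu
    filter_upwards [eventually_lt_side sch 2] with k hk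
    rw [cruxT_eq_zero_of_beta_zero r sch hu (hβ k) hk,
      cruxT_eq_zero_of_beta_zero r sch (tsupport_timeShiftTest_neg_one_past hu) (hβ k) hk, mul_zero]
  · intro u f g h hu
    exact tendsto_cruxKappa3_of_eventually_beta_zero r sch hu f g h (Eventually.of_forall hβ)

end ZeroCoupling


end Summit.QuantumFields.YangMills.Theorems.SkewnessNonGeneration.Negative

end
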